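import Summits.ABC.IUTFork.Conditional.AbcOfSGenuineKWindowThetaSzpiroBadBoth
import Summits.ABC.IUTFork.Cor312LicenceShallowRealising
import Summits.ABC.IUTFork.Repair.CandInternal11Gap
import HarnessLib

/-!
# D-0079 RESCUE sub-cell R-H («local-height condition I06⋆»), cut (C2) PLACE-CUT / DATUM-CUT — the k2 GLUE at the
# certificate of record: «movers on the WINDOW ∧ SZPIRO-BAD cells ⟹ `hSHwBad`», and «T4 (Szpiro-bad ⟹ deep) ⟹ `hSHwBad` is vacuous»

PROOF-ONLY file (D-0012: 0 definitions, 0 `Prop` facts; abc-iut cell, rung LADDER-ABC:A2.RP → A2.RESCUE-H; seat abc-iut-rp-j2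
gen 4 = R-H «k2 hand #4 + the C2 PLACE-CUT glue (I06⋆ demanded at Szpiro-bad data only, cf. cut of record p450130; W task T4
'Szpiro-bad ⇒ deep?' liaison)», abc-iut-rh-lead `plan/rescue/R-H/START-HERE.md` v1 §4 (C2) / §6). TAKES NO SIDE on [IUTchIII]
Cor. 3.12 or on any author; every R-H candidate is a HYPOTHESIS; typed ≠ proved; instantiated ≠ endorsed. Everything is consumed BY
NAME: the cut certificate `Conditional.abc_of_SH_v10K_window_szpiroBadBoth` (abc-iut-c312-d1 / C-cert, p450130), the mover
assembly `Thm311.Real.qRegion_subset_thetaHull_settingDHVolSharp_of_movers` / `exists_mover_of_norm_le` (abc-iut-w5-d236 p440064),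
`Thm311.Real.norm_qIdele_le_one_of_realises`, abc-iut-rp-d2's readings `CandInternal2.HInd3Hull` / `CandInternal11Gap.HQShellOrbitStar`.

WHY THE MOVER INTERFACE (§1, neutral bookkeeping). The certificate's per-datum target `hSHwBad` is abc-iut-w5-d068's
`Cor312Vol.PilotKummerCompatHull` at the genuine window bed `settingPrVolSharp (pilotDataOfK T.D T.K) …` read with the CONSTANT
region-forming operator `ρ := fun _ => P.qRegion`. At a constant `ρ` the abstract log-shell vocabulary of the B table degenerates:
RP-I06⋆ `HQShellOrbitStar S P (fun _ => P.qRegion) qK` holds for EVERY `qK` (`star_of_const_rho`) and RP-I05 `HInd3Hull S P (fun _ =>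
P.qRegion)` IS the hull clause itself (`hInd3Hull_const_rho_iff_hull`). So abc-iut-rp-h3's abstract window glue
`CandInternal11GapWindow.licence_of_starOn` carries no content at this bed, and the k2 glue of a place-cut / datum-cut candidate must run
through the arithmetic MOVER cells of branch C («at the place `x | p` and label `j` some `g ∈ Real.ismDH` has `‖t_{q,x}‖ ≤ ‖g(t_{Θ,j,x})‖`»)
— which is where R-H's HONEST reading of I06⋆ (START-HERE §1: `h(w,j) ≤ κ⁻(w)` DECIDED-POS / `> κ⁺(w)` DECIDED-NEG) lives.

§2 (every Dupuy–Hilado pilot datum `X`, sharp print-normalised bed, ANY columns and ANY `qK`):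
* `pilotKummerCompatHull_settingPrVolSharp_of_movers` — movers at every label `j ∈ {0,…,l⋇}` and place ⟹ the constant-`ρ` hull clause;
* `pilotKummerCompatHull_settingPrVolSharp_of_movers_labelSucc` — movers at the labels of `𝔽_l^⋇` only, for INTEGRAL q-ideles
  (`‖t_{q,x}‖ ≤ 1`, e.g. realising ones): the label `0` is the trivial mover (`t_{Θ,0} := 1`).
§3 (the cut certificate, verbatim binders of p450130):
* **`abc_of_MOV_v10K_window_szpiroBadBoth`** — `abc_of_SH_v10K_window_szpiroBadBoth` with `hSHwBad` REPLACED by `hMovBad`: «at every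
  admissible SZPIRO-BAD `(P, l)` and every datum `T` INSIDE THE WINDOW (¬deep), every cell `(x | p, j ∈ 𝔽_l^⋇)` of the genuine bed
  carries a mover for the chosen realising ideles». Explicit 3 = MOV(window ∧ Szpiro-bad) · NUM(deep ∧ Szpiro-bad) · CONE. This is the
  k2 TARGET SHAPE for every R-H candidate of cut type (C1 label-cut / C2 place-cut / C3 carrier): a candidate `H⋆` passes k2 at the
  certificate iff its cells supply these movers (cell ⟹ mover is branch C's per-packet theory: tame closed form
  `Cor312LicenceShallowRealTame`, deep band = R-W «U-SHAPE»).
* **`abc_of_T4_v10K_window_szpiroBadBoth`** — the W-task-T4 LIAISON in kernel: IF «admissible ∧ Szpiro-bad ⟹ deep» (`hT4`, a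
  HYPOTHESIS binder — R-W task T4, not asserted), THEN `hSHwBad` is VACUOUS and `ABC` follows from NUM(deep ∧ Szpiro-bad) · CONE alone:
  the whole hull-level / R-H question drops out of this certificate. Conversely the R-H programme matters for `ABC`-via-p450130
  exactly on the admissible SZPIRO-BAD data that are NOT deep (the datum-cut of record).

HONEST SCOPE. Pure composition over landed theorems; no cell is decided here; `hMovBad`, `hNumBad`, `hT4`, `hreg` are assumption labels;
«`ABC` follows from these hypotheses AS TYPED», nothing more. [claim: Mochizuki2012, status: disputed]
[cite: Mochizuki2012, IUTchIII Cor. 3.12 p. 173–174, Step (xi-f) p. 184; IUTchIV Thm. 1.10 p. 22–23] [cite: DupuyHilado2025, §3.9, §4.9]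
-/

noncomputable section

open Set Function NumberField IsDedekindDomain

namespace Summit.ABC.IUTFork.Repair.RHPlaceCutGlue

open Thm311 Thm311.Real Cor312 Cor312Vol Cor312Prov Literature.IUT.LogThetaLattice Literature.IUT.LogVolume
  Literature.IUT.HodgeTheaters Literature.IUT.LogVolume.ThetaData
open Literature.NumberTheory.DiophantineGeometry.GenEll Summit.ABC.ABC.Theorems
open Summit.ABC.IUTFork.Repair.CandInternal2 Summit.ABC.IUTFork.Repair.CandInternal11Gap

/-! ## §1. At a CONSTANT region-forming operator the abstract log-shell vocabulary degenerates -/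

section ConstRho

variable {T : ThetaIndex} (S : LatticeSituation T) (P : Cor312.Setting S.toSituation)
  (qK : ∀ v : T.V, v ∈ T.Vbad → Set (S.L.StarPacket v))

/-- **RP-I06⋆ is IDLE at a constant `ρ`**: with `ρ := fun _ => P.qRegion` the `𝔽_l^⋇`-form `HQShellOrbitStar` holds for every `qK`
(both sides are the q-pilot region). [folklore] -/
theorem star_of_const_rho : HQShellOrbitStar S P (fun _ => P.qRegion) qK := fun i vQ =>
  Set.subset_iUnion (fun _ : ℤ => P.qRegion (Setting.labelSucc i) vQ) 0

/-- **RP-I05 at a constant `ρ` IS the hull clause** «q-region ⊆ `ⁿ˒°𝒰_{j,v_ℚ}` at every label and place». [folklore] -/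
theorem hInd3Hull_const_rho_iff :
    HInd3Hull S P (fun _ => P.qRegion) ↔ ∀ (j : T.Label) (vQ : T.VQ), P.qRegion j vQ ⊆ P.thetaHull j vQ :=
  ⟨fun h j vQ => h 0 j vQ, fun h _ j vQ => h j vQ⟩

/-- … i.e. RP-I05 at the constant `ρ` ⟺ abc-iut-w5-d068's `PilotKummerCompatHull` at the constant `ρ` (any `qK`) — the binder
`hSHw`/`hSHwBad` of branch C's window certificates. [folklore] -/
theorem hInd3Hull_const_rho_iff_hull :
    HInd3Hull S P (fun _ => P.qRegion) ↔ PilotKummerCompatHull S P (fun _ => P.qRegion) qK :=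
  hInd3Hull_const_rho_iff S P

end ConstRho

/-! ## §2. The sharp genuine bed: movers ⟹ the constant-`ρ` hull clause (any columns, any `qK`) -/

section Sharp

variable {F : Type} [Field F] [NumberField F] (X : PilotData F) {logv : PadicLogs F} (hlog : LogvAnalytic logv)
  (M : Type) [Field M] [NumberField M]
  (archPk : ∀ (j : (thetaIndex X).Label) (vQ : (thetaIndex X).VQ), Set ((logShellsDH X logv).Packet j vQ))
  (archSub : ∀ (j : (thetaIndex X).Label) (v : (thetaIndex X).V),
    Set ((logShellsDH X logv).Packet j ((thetaIndex X).over v)))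
  (Ψ : ℤ → ∀ v : (thetaIndex X).V, v ∈ (thetaIndex X).Vbad → Set ((logShellsDH X logv).StarPacket v))
  (act : ℤ → ∀ v : (thetaIndex X).V, v ∈ (thetaIndex X).Vbad →
    (logShellsDH X logv).StarPacket v → Module.End ℚ ((logShellsDH X logv).StarPacket v))
  (Mmod : ℤ → ∀ j : (thetaIndex X).LabelStar, Set ((logShellsDH X logv).GlobalPacket j.1))
  (region : ℤ → ∀ j : (thetaIndex X).LabelStar, FinDivisor M → ∀ vQ : (thetaIndex X).VQ,
    Set ((logShellsDH X logv).Packet j.1 vQ))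
  (frobAdm : ℤ → ℤ → ∀ (j : (thetaIndex X).Label) (vQ : (thetaIndex X).VQ), Set ((logShellsDH X logv).Packet j vQ) → Prop)
  (frobLogvol : ℤ → ℤ → ∀ (j : (thetaIndex X).Label) (vQ : (thetaIndex X).VQ), Set ((logShellsDH X logv).Packet j vQ) → ℝ)
  (frobΨ : ℤ → ℤ → ∀ v : (thetaIndex X).V, v ∈ (thetaIndex X).Vbad → Set ((logShellsDH X logv).StarPacket v))
  (frobMmod : ℤ → ℤ → ∀ j : (thetaIndex X).LabelStar, Set ((logShellsDH X logv).GlobalPacket j.1))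
  (unitImage : ℤ → ℤ → ℕ → ∀ (j : (thetaIndex X).Label) (vQ : (thetaIndex X).VQ), Set ((logShellsDH X logv).Packet j vQ))
  (ballImage : ℤ → ℤ → ∀ (j : (thetaIndex X).Label) (vQ : (thetaIndex X).VQ), Set ((logShellsDH X logv).Packet j vQ))
  (thetaDiv : ℤ → ℤ → LgpDivisor M (thetaIndex X).lstar)
  (n : ℤ) {HT : Type} {LogLink : HT → HT → Type} {IsFull : ∀ {s t : HT}, LogLink s t → Prop}
  (lat : LGPGaussianLogThetaLattice LogLink IsFull)
  {Frd : Type} {IsoF : Frd → Frd → Type} {Ob : Frd → Type} {realify : Frd → Frd} {Strip : Type}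
  {IsoS : Strip → Strip → Type} {Mv : ∀ v : (thetaIndex X).V, v ∈ (thetaIndex X).Vbad → Type}
  [∀ v h, Monoid (Mv v h)]
  (sig : GlobalLGPFrobenioidSignature (thetaIndex X).lstar (thetaIndex X).V (· ∈ (thetaIndex X).Vbad)
    Frd IsoF Ob realify Strip IsoS Mv)
  (split : SplittingMonoids Mv) {ObΔ : Type} {N : ∀ v : (thetaIndex X).V, v ∈ (thetaIndex X).Vbad → Type}
  [∀ v h, Monoid (N v h)] (qData : QPilotData ObΔ N)
  (tq : ∀ (pp : Nat.Primes) (x : (thetaIndex X).Fibre (.inr pp)), haveI : Fact (pp : ℕ).Prime := ⟨pp.2⟩; kOf X pp.1 x)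
  (t : ∀ (pp : Nat.Primes) (_ : Fin X.lstar) (x : (thetaIndex X).Fibre (.inr pp)),
    haveI : Fact (pp : ℕ).Prime := ⟨pp.2⟩; kOf X pp.1 x)
  (htq0 : ∀ pp x, tq pp x ≠ 0)
  (htq1 : ∀ (pp : Nat.Primes) (x : (thetaIndex X).Fibre (.inr pp)),
    haveI : Fact (pp : ℕ).Prime := ⟨pp.2⟩; placeOf X pp.1 x ∉ X.S → ‖tq pp x‖ = 1)
  (qK : ∀ v : (thetaIndex X).V, v ∈ (thetaIndex X).Vbad → Set ((logShellsDH X logv).StarPacket v))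

/-- **MOVERS AT EVERY LABEL ⟹ the constant-`ρ` hull clause `PilotKummerCompatHull` at `settingPrVolSharp`** (the lattice situation
`LatticeSituation.ofShells` of the branch-C certificates over ANY column binders; any `qK`): abc-iut-w5-d236's packet assembly
`qRegion_subset_thetaHull_settingDHVolSharp_of_movers`, label by label. [claim: Mochizuki2012, status: disputed]
[cite: DupuyHilado2025, §3.9, §4.9] -/
theorem pilotKummerCompatHull_settingPrVolSharp_of_movers
    (hmov : ∀ (pp : Nat.Primes) (j : (thetaIndex X).Label) (x : (thetaIndex X).Fibre (.inr pp)),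
      haveI : Fact (pp : ℕ).Prime := ⟨pp.2⟩
      ∃ g ∈ ismDH logv x.1,
        ‖tq pp x‖ ≤ ‖(presAt X hlog pp).φ x (g (((presAt X hlog pp).φ x).symm (labelIdele X t pp j x)))‖) :
    PilotKummerCompatHull
      (LatticeSituation.ofShells (logShellsDH X logv) M archPk archSub (summandPiecesPr X hlog).Adm (summandPiecesPr X hlog).logvol
        Ψ act Mmod region frobAdm frobLogvol frobΨ frobMmod unitImage ballImage thetaDiv)
      (settingPrVolSharp X hlog M archPk archSub Ψ act Mmod region n lat sig split qData tq t htq0 htq1)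
      (fun _ => (settingPrVolSharp X hlog M archPk archSub Ψ act Mmod region n lat sig split qData tq t htq0 htq1).qRegion) qK :=
  fun j vQ =>
    qRegion_subset_thetaHull_settingDHVolSharp_of_movers X hlog M archPk archSub Ψ act Mmod region n lat sig split qData tq t htq0
      htq1 j vQ (hmov · j ·)

/-- **MOVERS AT THE LABELS OF `𝔽_l^⋇` ⟹ the hull clause, for INTEGRAL q-ideles** (`‖t_{q,x}‖ ≤ 1`, e.g. realising `P_q ≥ 0`): at the label
`0` the Θ-idele is `1` (`labelIdele_zero`) and the identity is a mover (`exists_mover_of_norm_le`). This is the shape an R-H candidate's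
cells supply (cells are indexed by `(x | p, j ∈ 𝔽_l^⋇)`). [claim: Mochizuki2012, status: disputed] [cite: DupuyHilado2025, §3.9, §4.9] -/
theorem pilotKummerCompatHull_settingPrVolSharp_of_movers_labelSucc
    (hint : ∀ (pp : Nat.Primes) (x : (thetaIndex X).Fibre (.inr pp)), haveI : Fact (pp : ℕ).Prime := ⟨pp.2⟩; ‖tq pp x‖ ≤ 1)
    (hmov : ∀ (pp : Nat.Primes) (i : Fin (thetaIndex X).lstar) (x : (thetaIndex X).Fibre (.inr pp)),
      haveI : Fact (pp : ℕ).Prime := ⟨pp.2⟩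
      ∃ g ∈ ismDH logv x.1,
        ‖tq pp x‖ ≤ ‖(presAt X hlog pp).φ x (g (((presAt X hlog pp).φ x).symm (t pp i x)))‖) :
    PilotKummerCompatHull
      (LatticeSituation.ofShells (logShellsDH X logv) M archPk archSub (summandPiecesPr X hlog).Adm (summandPiecesPr X hlog).logvol
        Ψ act Mmod region frobAdm frobLogvol frobΨ frobMmod unitImage ballImage thetaDiv)
      (settingPrVolSharp X hlog M archPk archSub Ψ act Mmod region n lat sig split qData tq t htq0 htq1)
      (fun _ => (settingPrVolSharp X hlog M archPk archSub Ψ act Mmod region n lat sig split qData tq t htq0 htq1).qRegion) qK := by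
  refine pilotKummerCompatHull_settingPrVolSharp_of_movers X hlog M archPk archSub Ψ act Mmod region frobAdm frobLogvol frobΨ frobMmod
    unitImage ballImage thetaDiv n lat sig split qData tq t htq0 htq1 qK fun pp j x => ?_
  haveI : Fact (pp : ℕ).Prime := ⟨pp.2⟩
  by_cases hj : j = 0
  · subst hj
    have h0 : labelIdele X t pp 0 x = 1 := by
      unfold labelIdele
      rw [dif_neg]
      simp
    refine exists_mover_of_norm_le X hlog tq t pp 0 x ?_
    rw [h0, norm_one]
    exact hint pp x
  · obtain ⟨i, rfl⟩ : ∃ i : Fin (thetaIndex X).lstar, j = Setting.labelSucc i :=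
      ⟨j.pred hj, (Fin.succ_pred j hj).symm⟩
    rw [labelIdele_labelSucc]
    exact hmov pp i x

end Sharp

end Summit.ABC.IUTFork.Repair.RHPlaceCutGlue

end
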